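import Mathlib
import Summits.ValiantsHypothesis.ValiantsHypothesis.Theorems.MonotoneRestorationOrbitRestorationQPLevelStructureA
import HarnessLib

/-!
# Structure of symmetric `ΣΠΣ(k)` circuits, II: the linear parts of the cluster sums have stable factor multisets (ORBIT currency)

Route MonotoneRestoration, crux `OrbitRestorationQP` (stmt-ValiantsHypothesis-18293), line `depth-three-rung`, registered stub
`stub_sigmaPiSigmaKValue` (A_k).  Namespace `Summit.ValiantsHypothesis.ValiantsHypothesis.Theorems.LevelStructure`.  Route-independent.

Layer L5 (c) of the formalisation plan of `Cruxes/OrbitRestorationQP/Lines/depth-three-rung-stubA-bounded-fanin.md` (§2 (f), first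
half), continuing `…LevelStructureA.lean` (a `Setting`: matrix-symmetric `f`, clean representation, good labelling):

* `Fall` — the product of the distinct nonzero cluster sums; it is FIXED by the whole matrix action (`mact_Fall`), of degree `≤ m·D`;
* `exists_support` — every degree-`1` divisor of `Fall` is fixed by the pointwise stabiliser (rows, resp. columns) of fewer than
  `c + 2` indices, provided `m·D < C(n, c+2)` (`…ProductAction.lean`: Dixon–Mortimer on the LINE, perfectness, affine upgrade);
* `act_eq_of_count`, `act_linNrm_eq` — hence the multiset of normalised degree-`1` factors of every nonzero cluster sum is stable
  under ALL row (resp. column) permutations: even ones fix the cluster sum, an odd one is corrected by a transposition inside the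
  complement of the support of the factor at hand;
* `exists_C_mul_linProd` — so each row/column permutation multiplies `Π linPart (F_a)` by a scalar.

Everything is proved modulo the named fact `depthThree_rankBound`, taken BY NAME as a hypothesis. [cite: KarninShpilka2009, §3;
DixonMortimer1996, Thm 5.2B; DawarWilsenach2025, Def. 6.1]
-/

noncomputable section

open MvPolynomial Equiv Literature.Computability.AlgebraicComplexity UniqueFactorizationMonoid

-- `Summit.ValiantsHypothesis.ValiantsHypothesis.…` is the tree's single-conjunct layout (Sub = Summit).
set_option linter.dupNamespace false

namespace Summit.ValiantsHypothesis.ValiantsHypothesis.Theorems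

namespace LevelStructure

open RankDistance LinNL LinearSubalgebra ProductAction LevelRep

variable {n : ℕ}

/-! ### Normalised multisets: two bookkeeping lemmas -/

section Nrm

variable {K : Type} [Field K] {V : Type} [DecidableEq (MvPolynomial V K)]

omit [DecidableEq (MvPolynomial V K)] in
/-- Related multisets have the same normalisation. [folklore] -/
theorem map_nrm_eq_of_rel {s t : Multiset (MvPolynomial V K)} (h : Multiset.Rel Associated s t) : s.map nrm = t.map nrm := by
  rw [← Multiset.rel_eq, Multiset.rel_map]
  exact h.mono fun a _ b _ hab => nrm_eq_of_associated hab

omit [DecidableEq (MvPolynomial V K)] in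
/-- Multisets with the same normalisation are related. [folklore] -/
theorem rel_of_map_nrm_eq {s t : Multiset (MvPolynomial V K)} (h : s.map nrm = t.map nrm) : Multiset.Rel Associated s t := by
  have h1 : Multiset.Rel (fun a b => nrm a = nrm b) s t := by
    rw [← Multiset.rel_map, Multiset.rel_eq]; exact h
  exact h1.mono fun a _ b _ hab => associated_of_nrm_eq hab

omit [DecidableEq (MvPolynomial V K)] in
/-- Acting after normalising is acting. [folklore] -/
theorem act_map_nrm (φ : MvPolynomial V K ≃ₐ[K] MvPolynomial V K) (L : Multiset (MvPolynomial V K)) :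
    act φ (L.map nrm) = act φ L := by
  rw [act, act, Multiset.map_map]
  exact Multiset.map_congr rfl fun q _ => nrm_eq_of_associated ((nrm_associated q).map φ)

/-- **A normalised multiset whose members keep their multiplicity under `nrm ∘ φ` is stable under the action of `φ`.** [folklore] -/
theorem act_eq_of_count (φ : MvPolynomial V K ≃ₐ[K] MvPolynomial V K) {M : Multiset (MvPolynomial V K)} (hM : IsNormalised M)
    (h : ∀ p ∈ M, M.count (nrm (φ p)) = M.count p) : act φ M = M := by
  refine Multiset.eq_of_le_of_card_le (Multiset.le_iff_count.2 fun x => ?_) (by rw [act, Multiset.card_map])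
  by_cases hx : x ∈ act φ M
  · obtain ⟨p, hp, rfl⟩ := Multiset.mem_map.1 hx
    rw [count_act φ hM (fun q hq => hq) hp, h p hp]
  · rw [Multiset.count_eq_zero_of_notMem hx]; exact Nat.zero_le _

end Nrm

namespace Setting

variable {D : ℕ} (S : Setting n D)

/-! ### The product of the nonzero cluster sums -/

/-- Cluster sums have total degree `≤ D`. [folklore] -/
theorem totalDegree_F_le (a : Fin S.R.m) : (S.F a).totalDegree ≤ D := by
  unfold F CleanRep.clusterSum CleanRep.T
  refine (totalDegree_finsetSum _ _).trans (Finset.sup_le fun i _ => ?_)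
  refine (totalDegree_mul _ _).trans ?_
  rw [totalDegree_C, zero_add]
  refine (MvPolynomial.totalDegree_multiset_prod _).trans ?_
  have : ((S.R.L i).map totalDegree) = (S.R.L i).map fun _ => 1 := Multiset.map_congr rfl fun q hq => S.R.hdeg i q hq
  rw [this, Multiset.map_const', Multiset.sum_replicate, smul_eq_mul, mul_one]
  exact S.R.hcard i

/-- The product of the distinct nonzero cluster sums. [folklore] -/
def Fall : MvPolynomial (Fin n × Fin n) ℂ := ∏ P ∈ S.labs.image S.F, P

/-- `Fall ≠ 0`. [folklore] -/
theorem Fall_ne_zero : S.Fall ≠ 0 := by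
  rw [Fall, Finset.prod_ne_zero_iff]
  intro P hP
  obtain ⟨a, ha, rfl⟩ := Finset.mem_image.1 hP
  exact S.F_ne_zero ha

/-- `F a ∣ Fall` for `a ∈ labs`. [folklore] -/
theorem F_dvd_Fall {a : Fin S.R.m} (ha : a ∈ S.labs) : S.F a ∣ S.Fall :=
  Finset.dvd_prod_of_mem _ (Finset.mem_image_of_mem _ ha)

/-- **`Fall` is fixed by the whole matrix action** (which permutes the nonzero cluster sums). [folklore] -/
theorem mact_Fall (hRB : depthThree_rankBound) (σ τ : Perm (Fin n)) : mact σ τ S.Fall = S.Fall := by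
  classical
  set T := S.labs.image S.F with hT
  have hsub : T.image (mact σ τ) ⊆ T := by
    intro P hP
    obtain ⟨Q, hQ, rfl⟩ := Finset.mem_image.1 hP
    obtain ⟨b, hb, rfl⟩ := Finset.mem_image.1 hQ
    obtain ⟨a, ha⟩ := (S.perm_clusterSum hRB σ τ).2 b
    rw [ha]
    refine Finset.mem_image_of_mem _ (S.mem_labs_of_F_ne_zero ?_)
    rw [← ha]; exact (map_ne_zero_iff _ (mact σ τ).injective).2 (S.F_ne_zero hb)
  have heq : T.image (mact σ τ) = T :=
    Finset.eq_of_subset_of_card_le hsub (by rw [Finset.card_image_of_injective _ (mact σ τ).injective])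
  rw [Fall, ← hT, map_prod]
  conv_rhs => rw [← heq]
  rw [Finset.prod_image fun x _ y _ h => (mact σ τ).injective h]

/-- `deg Fall ≤ m · D`. [folklore] -/
theorem totalDegree_Fall_le : S.Fall.totalDegree ≤ S.R.m * D := by
  classical
  unfold Fall
  refine (totalDegree_finsetProd _ _).trans ?_
  calc ∑ P ∈ S.labs.image S.F, P.totalDegree ≤ ∑ P ∈ S.labs.image S.F, D := Finset.sum_le_sum fun P hP => by
        obtain ⟨a, -, rfl⟩ := Finset.mem_image.1 hP; exact S.totalDegree_F_le a
    _ = (S.labs.image S.F).card * D := by rw [Finset.sum_const, smul_eq_mul]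
    _ ≤ S.R.m * D := Nat.mul_le_mul_right _ (Finset.card_image_le.trans (Finset.card_image_le.trans (by simp)))

/-! ### Supports of the degree-one divisors of `Fall` -/

/-- **Every degree-`1` divisor of `Fall` has a small support** for a local action fixing `Fall`: it is fixed by every permutation
fixing pointwise some set of fewer than `c + 2` indices. [cite: DixonMortimer1996, Thm 5.2B; DawarWilsenach2025, Def. 6.1] -/
theorem exists_support {g : Perm (Fin n) →* Perm (Fin n × Fin n)} (hg : IsLocal g)
    (hinv : ∀ ρ : Perm (Fin n), vact (K := ℂ) g ρ S.Fall = S.Fall) {c : ℕ} (hc1 : S.R.m * D < n.choose (c + 2))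
    (hc2 : 4 * (c + 2) ≤ n) (hc3 : c + 7 ≤ n) {q : MvPolynomial (Fin n × Fin n) ℂ} (hq1 : q.totalDegree = 1) (hdvd : q ∣ S.Fall) :
    ∃ Y : Finset (Fin n), Y.card < c + 2 ∧ ∀ ρ : Perm (Fin n), (∀ x ∈ Y, ρ x = x) → vact (K := ℂ) g ρ q = q := by
  classical
  -- the images of the line of `q` are lines of degree-one factors of `Fall`
  set Tq : Finset (MvPolynomial (Fin n × Fin n) ℂ) := ((linPart S.Fall).map nrm).toFinset with hTq
  have hsub : (Set.range fun ρ : Perm (Fin n) => nrm (vact (K := ℂ) g ρ q)) ⊆ ↑Tq := by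
    rintro _ ⟨ρ, rfl⟩
    have hd : vact (K := ℂ) g ρ q ∣ S.Fall := by rw [← hinv ρ]; exact map_dvd _ hdvd
    have hdeg : (vact (K := ℂ) g ρ q).totalDegree = 1 := by rw [vact_apply, totalDegree_rename_equiv]; exact hq1
    have hirr : Irreducible (vact (K := ℂ) g ρ q) := (RankBoundBridge.prime_of_totalDegree_eq_one hdeg).irreducible
    obtain ⟨q', hq', hassoc⟩ := exists_mem_factors_of_dvd S.Fall_ne_zero hirr hd
    have hq'1 : q'.totalDegree = 1 := by rw [← totalDegree_eq_of_associated hassoc, hdeg]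
    rw [hTq, Finset.mem_coe, Multiset.mem_toFinset]
    exact Multiset.mem_map.2 ⟨q', Multiset.mem_filter.2 ⟨hq', hq'1⟩, (nrm_eq_of_associated hassoc).symm⟩
  have hfin : (Set.range fun ρ : Perm (Fin n) => nrm (vact (K := ℂ) g ρ q)).Finite := (Finset.finite_toSet _).subset hsub
  have hlt : (Set.range fun ρ : Perm (Fin n) => nrm (vact (K := ℂ) g ρ q)).ncard < n.choose (c + 2) := by
    refine lt_of_le_of_lt ?_ hc1
    calc (Set.range fun ρ : Perm (Fin n) => nrm (vact (K := ℂ) g ρ q)).ncard ≤ (↑Tq : Set _).ncard :=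
          Set.ncard_le_ncard hsub (Finset.finite_toSet _)
      _ = Tq.card := Set.ncard_coe_finset _
      _ ≤ Multiset.card (linPart S.Fall) := by
          rw [hTq]; exact (Multiset.toFinset_card_le _).trans (by rw [Multiset.card_map])
      _ ≤ S.Fall.totalDegree := card_linPart_le S.Fall_ne_zero
      _ ≤ S.R.m * D := S.totalDegree_Fall_le
  obtain ⟨Y, hYc, hY⟩ := altFixLine_of_ncard_lt (vact (K := ℂ) g) S.hn8 (by omega) hc2 q hfin hlt
  have hq0 : q ≠ 0 := by rintro rfl; rw [totalDegree_zero] at hq1; exact zero_ne_one hq1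
  have hfix := fix_of_fixLine (vact (K := ℂ) g) (Y := Y) (by omega) hq0 hY
  exact ⟨Y, hYc, symFix_of_altFix_affine hg (by omega) hq1.le hfix⟩

/-! ### Stability of the normalised linear factor multisets -/

/-- The normalised multiset of the degree-one factors of the cluster sum of `a`. [folklore] -/
def linNrm (a : Fin S.R.m) : Multiset (MvPolynomial (Fin n × Fin n) ℂ) := (linPart (S.F a)).map nrm

/-- `linNrm a` is normalised. [folklore] -/
theorem isNormalised_linNrm (a : Fin S.R.m) : IsNormalised (S.linNrm a) := fun q hq => by
  obtain ⟨q', -, rfl⟩ := Multiset.mem_map.1 hq; exact nrm_nrm q'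

/-- Members of `linNrm a` have degree `1` and divide `F a`. [folklore] -/
theorem mem_linNrm {a : Fin S.R.m} (ha : a ∈ S.labs) {p : MvPolynomial (Fin n × Fin n) ℂ} (hp : p ∈ S.linNrm a) :
    p.totalDegree = 1 ∧ p ∣ S.F a := by
  obtain ⟨q, hq, rfl⟩ := Multiset.mem_map.1 hp
  refine ⟨by rw [totalDegree_nrm]; exact totalDegree_of_mem_linPart hq, (nrm_associated q).dvd.trans ?_⟩
  exact (Multiset.dvd_prod (Multiset.mem_of_le (Multiset.filter_le _ _) hq)).trans (factors_prod (S.F_ne_zero ha)).dvd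

/-- **The normalised linear factor multiset of a nonzero cluster sum is stable under every permutation of a local action** whose even
elements fix the cluster sum and which fixes `Fall`. [folklore] -/
theorem act_linNrm_eq (hRB : depthThree_rankBound) {g : Perm (Fin n) →* Perm (Fin n × Fin n)} (hg : IsLocal g)
    (hfixF : ∀ a, ∀ ρ : Perm (Fin n), Perm.sign ρ = 1 → vact (K := ℂ) g ρ (S.F a) = S.F a)
    (hinv : ∀ ρ : Perm (Fin n), vact (K := ℂ) g ρ S.Fall = S.Fall) {c : ℕ} (hc1 : S.R.m * D < n.choose (c + 2))
    (hc2 : 4 * (c + 2) ≤ n) (hc3 : c + 7 ≤ n) {a : Fin S.R.m} (ha : a ∈ S.labs) (σ : Perm (Fin n)) :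
    act (vact (K := ℂ) g σ) (S.linNrm a) = S.linNrm a := by
  classical
  have _ := hRB
  have hF0 := S.F_ne_zero ha
  -- even permutations
  have heven : ∀ ρ : Perm (Fin n), Perm.sign ρ = 1 → act (vact (K := ℂ) g ρ) (S.linNrm a) = S.linNrm a := by
    intro ρ hρ
    rw [linNrm, act_map_nrm, act]
    have hmm : Multiset.map (fun q => nrm (vact (K := ℂ) g ρ q)) (linPart (S.F a)) = ((linPart (S.F a)).map (vact (K := ℂ) g ρ)).map nrm := by
      rw [Multiset.map_map]; rfl
    rw [hmm]
    refine (map_nrm_eq_of_rel ?_).symm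
    have h := linPart_map (vact (K := ℂ) g ρ) (fun q => by rw [vact_apply, totalDegree_rename_equiv]) hF0
    rw [hfixF a ρ hρ] at h
    exact h
  -- count invariance for every permutation
  refine act_eq_of_count _ (S.isNormalised_linNrm a) fun p hp => ?_
  obtain ⟨hp1, hpd⟩ := S.mem_linNrm ha hp
  obtain ⟨Y, hYc, hY⟩ := S.exists_support hg hinv hc1 hc2 hc3 hp1 (hpd.trans (S.F_dvd_Fall ha))
  -- correct an odd permutation by a transposition away from `Y`
  obtain ⟨ρ, hρs, hρp⟩ : ∃ ρ : Perm (Fin n), Perm.sign ρ = 1 ∧ vact (K := ℂ) g σ p = vact (K := ℂ) g ρ p := by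
    rcases Int.units_eq_one_or (Perm.sign σ) with hs | hs
    · exact ⟨σ, hs, rfl⟩
    · have hbig : 1 < (Finset.univ \ Y).card := by
        rw [Finset.card_sdiff_of_subset (Finset.subset_univ _), Finset.card_univ, Fintype.card_fin]; omega
      obtain ⟨u, hu, w, hw, huw⟩ := Finset.one_lt_card.1 hbig
      simp only [Finset.mem_sdiff, Finset.mem_univ, true_and] at hu hw
      refine ⟨σ * swap u w, by rw [Perm.sign_mul, Perm.sign_swap huw, hs]; decide, ?_⟩
      rw [map_mul, AlgEquiv.mul_apply, hY (swap u w) fun x hx => swap_apply_of_ne_of_ne (by rintro rfl; exact hu hx)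
        (by rintro rfl; exact hw hx)]
  rw [hρp]
  have := heven ρ hρs
  rw [← count_act (vact (K := ℂ) g ρ) (S.isNormalised_linNrm a) (fun q hq => hq) hp, this]

/-- **Each permutation of such an action multiplies `Π linPart (F a)` by a scalar.** [folklore] -/
theorem exists_C_mul_linProd (hRB : depthThree_rankBound) {g : Perm (Fin n) →* Perm (Fin n × Fin n)} (hg : IsLocal g)
    (hfixF : ∀ a, ∀ ρ : Perm (Fin n), Perm.sign ρ = 1 → vact (K := ℂ) g ρ (S.F a) = S.F a)
    (hinv : ∀ ρ : Perm (Fin n), vact (K := ℂ) g ρ S.Fall = S.Fall) {c : ℕ} (hc1 : S.R.m * D < n.choose (c + 2))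
    (hc2 : 4 * (c + 2) ≤ n) (hc3 : c + 7 ≤ n) {a : Fin S.R.m} (ha : a ∈ S.labs) (σ : Perm (Fin n)) :
    ∃ χ : ℂ, χ ≠ 0 ∧ vact (K := ℂ) g σ (linPart (S.F a)).prod = C χ * (linPart (S.F a)).prod := by
  have h := S.act_linNrm_eq hRB hg hfixF hinv hc1 hc2 hc3 ha σ
  rw [linNrm, act_map_nrm, act] at h
  have hmm : Multiset.map (fun q => nrm (vact (K := ℂ) g σ q)) (linPart (S.F a)) = ((linPart (S.F a)).map (vact (K := ℂ) g σ)).map nrm := by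
    rw [Multiset.map_map]; rfl
  rw [hmm] at h
  have hrel := rel_of_map_nrm_eq h
  obtain ⟨w, hw⟩ := (prod_associated_of_rel hrel).symm
  obtain ⟨χ, hχ, hwχ⟩ := MvPolynomial.isUnit_iff_eq_C_of_isReduced.1 w.isUnit
  refine ⟨χ, hχ.ne_zero, ?_⟩
  rw [map_multiset_prod, ← hw, hwχ, mul_comm]

end Setting

end LevelStructure

end Summit.ValiantsHypothesis.ValiantsHypothesis.Theorems

end
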